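import Literature.AlgebraicGeometry.Resolution.CohenMacaulayCatenary
import Literature.AlgebraicGeometry.Resolution.CoefficientRingsProofs
import Literature.AlgebraicGeometry.Resolution.AdicCompletionRegular
import HarnessLib

/-!
# Complete Noetherian local rings are universally catenary (Stacks 032C)

Topic: `Literature/AlgebraicGeometry/Resolution`. The universally-catenary conjunct of the named
fact `Stacks07QW_complete` (`ExcellentRings.lean`; Stacks 07QW (2): Noetherian complete local
rings are excellent). Stacks 07QW, proof: "Any Cohen-Macaulay ring is universally catenary, see
Algebra, Lemma 00NM. In particular … regular rings are universally catenary. Via the Cohen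
structure theorem we see that complete local rings are universally catenary, see Algebra,
Remark 032C." Here the Cohen structure theorem enters through Matsumura's Thm. 29.4 (iii)
(`Matsumura1987_29_4_iii_holds`: a complete local DOMAIN is finite over a complete regular local
subring) applied to the quotients `A/𝔭₀` by minimal primes — catenarity of a finitely generated
`A`-algebra `B` between primes `P ⊆ Q` is decided in `B/𝔭₀B` (`CatenaryRings.lean`,
`isCatenaryRing_of_forall_exists_quotient`), which is of finite type over the regular ring `A'`,
universally catenary by `isUniversallyCatenaryRing_of_isRegularRing'`
(`CohenMacaulayCatenary.lean`). Everything is PROVED.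

## Content

* `isUniversallyCatenaryRing_of_isAdicComplete` — Stacks 032C.

## Sources

* The Stacks Project, Tag 032C (Remark 10.160.9), Tag 07QW (proof). [StacksProject]
* H. Matsumura, *Commutative Ring Theory*, CUP 1986, Thm. 29.4 (iii) p. 225; §32 p. 260 ("A
  complete Noetherian local ring is excellent"). [Matsumura1987]
-/

noncomputable section

open IsLocalRing

namespace Literature.AlgebraicGeometry.Resolution

universe u

/-- **Stacks 032C: a Noetherian complete local ring is universally catenary** ("the Cohen
structure theorem implies that any Noetherian complete local ring is a quotient of a regular
local ring. In particular we see that a Noetherian complete local ring is universally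
catenary"). Proof here: for `B` of finite type over `A` and primes `P ⊆ Q` of `B`, let `𝔭₀ ⊆ P ∩ A`
be a minimal prime; `A/𝔭₀` is a complete local domain, finite over a complete regular local
subring `A'` (Matsumura Thm. 29.4 (iii)), so `B/𝔭₀B` is of finite type over the universally
catenary ring `A'` (regular rings are universally catenary), hence catenary; and the saturated
chains between `P` and `Q` live in `Spec(B/𝔭₀B)`. [cite: StacksProject, Tag 032C] -/
theorem isUniversallyCatenaryRing_of_isAdicComplete (A : Type u) [CommRing A] [IsLocalRing A]
    [IsNoetherianRing A] [IsAdicComplete (maximalIdeal A) A] : IsUniversallyCatenaryRing A := by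
  refine ⟨‹_›, fun B _ _ hB => ?_⟩
  refine isCatenaryRing_of_forall_exists_quotient fun P Q _ => ?_
  -- a minimal prime `𝔭₀` of `A` below `P ∩ A`
  obtain ⟨p₀, hp₀, hp₀P⟩ := Ideal.exists_minimalPrimes_le
    (show (⊥ : Ideal A) ≤ P.asIdeal.comap (algebraMap A B) from bot_le)
  haveI hp₀prime : p₀.IsPrime := hp₀.1.1
  set J : Ideal B := p₀.map (algebraMap A B) with hJ
  refine ⟨J, Ideal.map_le_iff_le_comap.mpr hp₀P, ?_⟩
  -- `A₀ = A/𝔭₀` is a complete Noetherian local domain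
  haveI : Nontrivial (A ⧸ p₀) := Ideal.Quotient.nontrivial_iff.mpr hp₀prime.ne_top
  haveI : IsLocalRing (A ⧸ p₀) :=
    IsLocalRing.of_surjective' (Ideal.Quotient.mk p₀) Ideal.Quotient.mk_surjective
  haveI : IsDomain (A ⧸ p₀) := Ideal.Quotient.isDomain p₀
  haveI : IsAdicComplete (maximalIdeal (A ⧸ p₀)) (A ⧸ p₀) := isAdicComplete_quotient p₀
  -- Cohen: `A/𝔭₀` is finite over a complete regular local subring `A'`
  obtain ⟨A', hA'reg, -, hA'fin⟩ := Matsumura1987_29_4_iii_holds (A ⧸ p₀)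
  haveI := hA'reg
  haveI : IsRegularRing A' := isRegularRing_of_isRegularLocalRing A'
  have hUC : IsUniversallyCatenaryRing A' := isUniversallyCatenaryRing_of_isRegularRing' A'
  -- `B/J` is of finite type over `A/𝔭₀`, hence over `A'`
  have hle : p₀ ≤ J.comap (algebraMap A B) := Ideal.le_comap_map
  letI : Algebra (A ⧸ p₀) (B ⧸ J) := Ideal.Quotient.algebraQuotientOfLEComap hle
  haveI : IsScalarTower A (A ⧸ p₀) (B ⧸ J) := IsScalarTower.of_algebraMap_eq fun a => rfl
  haveI : Algebra.FiniteType A (B ⧸ J) := hB.trans inferInstance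
  haveI : Algebra.FiniteType (A ⧸ p₀) (B ⧸ J) :=
    Algebra.FiniteType.of_restrictScalars_finiteType A (A ⧸ p₀) (B ⧸ J)
  letI : Algebra A' (B ⧸ J) :=
    ((algebraMap (A ⧸ p₀) (B ⧸ J)).comp (algebraMap A' (A ⧸ p₀))).toAlgebra
  haveI : IsScalarTower A' (A ⧸ p₀) (B ⧸ J) := IsScalarTower.of_algebraMap_eq fun _ => rfl
  haveI : Module.Finite A' (A ⧸ p₀) := hA'fin
  haveI : Algebra.FiniteType A' (B ⧸ J) :=
    (Module.Finite.finiteType (A ⧸ p₀) : Algebra.FiniteType A' (A ⧸ p₀)).trans ‹_›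
  exact hUC.isCatenaryRing_of_finiteType (B ⧸ J)

end Literature.AlgebraicGeometry.Resolution
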